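import Summits.FinalStateConjecture.FinalStateConjecture.Statement
import Literature.Geometry.Lorentzian.RecedingKerrInitialLayerNorm
import HarnessLib

/-!
# `DerivativeThrift.ThriftyHandoff` (item stmt-FinalStateConjecture-17612): the per-datum property and
# its development-level clauses, named (definitions only)

The crux `Summit.FinalStateConjecture.FinalStateConjecture.Theses.DerivativeThrift.ThriftyHandoff`
reads `∀ X, IsTameChristodoulouGeneric (admissibleVacuumData X) (fun D ↦ <ThriftyProp D>) 1`. The line
of the crux (`Cruxes/ThriftyHandoff/Lines/birth.lean`) and its helpers manipulate the per-datum
property and its development-level clauses as objects — the censorship curve kernel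
(`InitialDataSet.isTameChristodoulouGeneric_of_relative'`), transport along re-indexings of the
data (`VacuumCauchyDevelopment.precomp`, breathing self-witnesses), the weak ⇒ full upgrade — so
they are named here ONCE, verbatim, Theses-free (this module imports only the Statement and the
Lorentz prelude, so that files importing it close no import cycle with the gate-rendered route
file; pattern of `EIHFluxBalanceModulatedKerrHandoffTameDefs`):

* `WeakHandoff 𝒟` — the WEAK thrifty hand-over of a vacuum Cauchy development `𝒟`: `N ≥ 0` holes
  with CLOSED Kerr labels (`|aᵢ| < Mᵢ` or extremal), orthochronous Lorentz motions, and for every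
  scale `ℓ > 0`, accuracy `ε > 0` and lab time `τ₁` a later lab time, `ε⁻¹`-separated non-approaching
  centres and a smooth open embedding of the `N`-hole hyperboloidal layer `RecedingKerr.layer` into
  `J⁺(ιX)` with achronal leaves and `k = 2` layer norm `𝔑_(2,1/2,1/2) ≤ ε` (the conclusion of the
  line's stub `stub_censoredCapture`, verbatim);
* `FullHandoff 𝒟` — the hand-over clause (iii) of the crux verbatim: the same with SUB-EXTREMAL
  labels and pairwise distinct terminal 3-velocities (= the antecedent of
  `DerivativeThrift.ThriftyClusterSettling`);
* `RaysCaptured 𝒟` — clause (ii) of the crux verbatim: rays are captured by every honest typed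
  decomposition (the body of item stmt-FinalStateConjecture-17673 `SettledExteriorHoldsRays` after
  its censorship hypothesis);
* `Censored D` — an MGHD exists and every MGHD has complete `𝓘⁺` (the per-datum property of item
  stmt-FinalStateConjecture-17269 `WeakCosmicCensorshipTame`, verbatim its `fun D ↦ …`);
* `UpgradableCensored D` — an MGHD exists and every MGHD has complete `𝓘⁺` AND upgrades weak
  hand-overs to full ones (the property produced along censorship curves by the line's
  transversality stub);
* `ThriftyProp D` — the crux's per-datum property verbatim, so that `ThriftyHandoff` is (by
  `Iff.rfl`) `∀ X, IsTameChristodoulouGeneric (admissibleVacuumData X) ThriftyProp 1`.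

Two one-line bookkeeping lemmas (`UpgradableCensored.censored`, `thriftyProp_of_upgradableCensored`)
record the pointwise implications the line's glue uses. No analysis is claimed here. Sources of the
clause list: Dafermos–Luk arXiv:1710.01722, Conjecture 1 and §1.2.1; Klainerman–Szeftel
arXiv:2104.11857 §3.6 (initial layer norm); Christodoulou CQG 16 (1999) A23, p. A24 (genericity).
-/

noncomputable section

namespace Summit.FinalStateConjecture.FinalStateConjecture.Theorems.DerivativeThriftThriftyHandoff

open scoped Topology Manifold ContDiff ENNReal
open Filter Set Function TopologicalSpace Literature.Geometry.Lorentzian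

-- D-0017: single-problem summit, `Summit.<S>.<S>.…` by design.
set_option linter.dupNamespace false

variable {X : Type} [TopologicalSpace X] [ChartedSpace E3 X] [IsManifold (𝓡 3) ((⊤ : ℕ∞) : WithTop ℕ∞) X]
  [ConnectedSpace X]

/-- **The WEAK thrifty hand-over** of the vacuum Cauchy development `𝒟`: there are `N ≥ 0`, CLOSED
Kerr labels (`Kerr.IsSubextremal ∨ Kerr.IsExtremal` — extremal end states allowed pointwise,
Kehle–Unger arXiv:2211.15742), orthochronous Lorentz motions `Λᵢ` (no condition on the terminal
velocities), such that for every scale `ℓ > 0`, accuracy `ε > 0` and lab time `τ₁` there are a lab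
time `τ ≥ τ₁`, centres `ξᵢ` pairwise `≥ ε⁻¹` apart and non-approaching, and a smooth open embedding
`Φ` of the `N`-hole hyperboloidal layer `RecedingKerr.layer M a Λ ξ τ ℓ` into `J⁺(ιX)` with achronal
leaves and `k = 2` layer norm `𝔑_(2,1/2,1/2)(Φ) ≤ ε`. Verbatim the conclusion of the line's stub
`stub_censoredCapture`. Dafermos–Luk arXiv:1710.01722, §1.2.1 (the final-state picture);
Klainerman–Szeftel arXiv:2104.11857, §3.6 (initial layer norm). [cite: DafermosLuk2017, §1.2.1] -/
def WeakHandoff {D : InitialDataSet (𝓡 3) X} (𝒟 : VacuumCauchyDevelopment D) : Prop :=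
  ∃ (N : ℕ) (M a : Fin N → ℝ) (Λ : Fin N → ↥lorentzGroup), (∀ i, Kerr.IsSubextremal (M i) (a i) ∨ Kerr.IsExtremal (M i) (a i)) ∧ (∀ i, Summit.FinalStateConjecture.IsOrthochronous (Λ i)) ∧ ∀ ℓ : ℝ, 0 < ℓ → ∀ ε : ℝ, 0 < ε → ∀ τ₁ : ℝ, ∃ τ : ℝ, τ₁ ≤ τ ∧ ∃ (ξ : Fin N → E3) (Φ : RecedingKerr.layer M a Λ ξ τ ℓ → 𝒟.carrier), (∀ i j, i ≠ j → ε⁻¹ ≤ ‖ξ i - ξ j‖ ∧ 0 ≤ @inner ℝ E3 _ (ξ i - ξ j) ( (((Λ i : E4 ≃L[ℝ] E4) (E4.basisVector 0)) 0)⁻¹ • E4.spatial ((Λ i : E4 ≃L[ℝ] E4) (E4.basisVector 0)) - (((Λ j : E4 ≃L[ℝ] E4) (E4.basisVector 0)) 0)⁻¹ • E4.spatial ((Λ j : E4 ≃L[ℝ] E4) (E4.basisVector 0)))) ∧ ContMDiff 𝓘(ℝ, E4) (𝓡 4) ((⊤ : ℕ∞) : WithTop ℕ∞) Φ ∧ Topology.IsOpenEmbedding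 Φ ∧ Set.range Φ ⊆ 𝒟.metric.causalFuture 𝒟.timeOrientation (Set.range 𝒟.embed) ∧ (∀ s₀ ∈ Set.Ioo 0 ℓ, 𝒟.metric.IsAchronal 𝒟.timeOrientation (Φ '' {x | RecedingKerr.layerTime τ ℓ x.1 = s₀})) ∧ 𝒟.toSpacetime.recedingKerrInitialLayerNorm M a Λ ξ τ ℓ 2 (1 / 2) (1 / 2) Φ ≤ ENNReal.ofReal ε

/-- **The (full) thrifty hand-over** of the vacuum Cauchy development `𝒟` — clause (iii) of the crux
`DerivativeThrift.ThriftyHandoff` verbatim (= the antecedent of `DerivativeThrift.ThriftyClusterSettling`):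
as `WeakHandoff` but with SUB-EXTREMAL labels `|aᵢ| < Mᵢ` and pairwise distinct terminal
3-velocities `vᵢ = (Λᵢe₀)⁰⁻¹ (Λᵢe₀)̲`. Dafermos–Luk arXiv:1710.01722, §1.2.1 ("finitely many Kerr black
holes moving away from each other"). [cite: DafermosLuk2017, §1.2.1] -/
def FullHandoff {D : InitialDataSet (𝓡 3) X} (𝒟 : VacuumCauchyDevelopment D) : Prop :=
  ∃ (N : ℕ) (M a : Fin N → ℝ) (Λ : Fin N → ↥lorentzGroup), (∀ i, Kerr.IsSubextremal (M i) (a i)) ∧ (∀ i, Summit.FinalStateConjecture.IsOrthochronous (Λ i)) ∧ (∀ i j, i ≠ j → (((Λ i : E4 ≃L[ℝ] E4) (E4.basisVector 0)) 0)⁻¹ • E4.spatial ((Λ i : E4 ≃L[ℝ] E4) (E4.basisVector 0)) ≠ (((Λ j : E4 ≃L[ℝ] E4) (E4.basisVector 0)) 0)⁻¹ • E4.spatial ((Λ j : E4 ≃L[ℝ] E4) (E4.basisVector 0))) ∧ ∀ ℓ : ℝ, 0 < ℓ → ∀ ε : ℝ, 0 < ε → ∀ τ₁ : ℝ, ∃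 τ : ℝ, τ₁ ≤ τ ∧ ∃ (ξ : Fin N → E3) (Φ : RecedingKerr.layer M a Λ ξ τ ℓ → 𝒟.carrier), (∀ i j, i ≠ j → ε⁻¹ ≤ ‖ξ i - ξ j‖ ∧ 0 ≤ @inner ℝ E3 _ (ξ i - ξ j) ( (((Λ i : E4 ≃L[ℝ] E4) (E4.basisVector 0)) 0)⁻¹ • E4.spatial ((Λ i : E4 ≃L[ℝ] E4) (E4.basisVector 0)) - (((Λ j : E4 ≃L[ℝ] E4) (E4.basisVector 0)) 0)⁻¹ • E4.spatial ((Λ j : E4 ≃L[ℝ] E4) (E4.basisVector 0)))) ∧ ContMDiff 𝓘(ℝ, E4) (𝓡 4) ((⊤ : ℕ∞) : WithTop ℕ∞) Φ ∧ Topology.IsOpenEmbedding Φ ∧ Set.range Φ ⊆ 𝒟.metric.causalFuture 𝒟.timeOrientation (Set.range 𝒟.embed) ∧ (∀ s₀ ∈ Set.Ioo 0 ℓ, 𝒟.metric.IsAchronal 𝒟.timeOrientation (Φ '' {x | RecedingKerr.layerTime τ ℓ x.1 = s₀})) ∧ 𝒟.toSpacetime.recedingKerrInitialLayerNorm M a Λ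 ξ τ ℓ 2 (1 / 2) (1 / 2) Φ ≤ ENNReal.ofReal ε

/-- **Rays are captured by every honest typed decomposition** of the development `𝒟` — clause (ii)
of the crux verbatim: for every `N`-hole `C²` final-state decomposition `d` of a region `O` with
sub-extremal holes, `O = exteriorOf 𝒟 d.charted`, `HasExhaustiveCharts d` and `IsFutureOriented d`,
every future-complete normalised null ray from the data stays in `closure O`
(`Summit.FinalStateConjecture.RaysStayInClosure`). The body of item stmt-FinalStateConjecture-17673
(`SettledExteriorHoldsRays`) after its hypotheses on the datum and the development.
Dafermos–Luk arXiv:1710.01722, Conjecture 1. [cite: DafermosLuk2017, Conjecture 1] -/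
def RaysCaptured {D : InitialDataSet (𝓡 3) X} (𝒟 : VacuumCauchyDevelopment D) : Prop :=
  ∀ (O : Set 𝒟.carrier) (d : FinalStateDecomposition 𝒟.toSpacetime O 2), (∀ i, Kerr.IsSubextremal (d.mass i) (d.spin i)) → O = Summit.FinalStateConjecture.exteriorOf 𝒟.toCauchyDevelopment d.charted → Summit.FinalStateConjecture.HasExhaustiveCharts d → Summit.FinalStateConjecture.IsFutureOriented d → Summit.FinalStateConjecture.RaysStayInClosure 𝒟.toCauchyDevelopment O

/-- **Censored datum** (weak cosmic censorship at `D`, MGHD form): a maximal vacuum Cauchy development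
of `D` exists and EVERY maximal one has complete future null infinity (sojourn form) — verbatim the
`fun D ↦ …` of item stmt-FinalStateConjecture-17269 (`PhaseMixingCapture.WeakCosmicCensorshipTame`).
Christodoulou, CQG 16 (1999) A23, p. A24; Dafermos–Rodnianski arXiv:0811.0354, §2.6.2. [cite: Christodoulou1999, p. A24] -/
def Censored (D : InitialDataSet (𝓡 3) X) : Prop :=
  (∃ 𝒟 : VacuumCauchyDevelopment D, 𝒟.IsMaximal) ∧
    ∀ 𝒟 : VacuumCauchyDevelopment D, 𝒟.IsMaximal →
      Summit.FinalStateConjecture.HasCompleteNullInfinity 𝒟.toCauchyDevelopment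

/-- **Upgradably censored datum**: an MGHD of `D` exists, and every MGHD of `D` has complete `𝓘⁺` AND
upgrades every weak thrifty hand-over to a full one (`WeakHandoff 𝒟 → FullHandoff 𝒟`: the generic
third law `|aᵢ| < Mᵢ` and generic hyperbolic recession `vᵢ ≠ vⱼ` at the level of this datum). The
property the line produces ALONG censorship curves (`isTameChristodoulouGeneric_of_relative'`).
Christodoulou, CQG 16 (1999) A23, p. A24; Kehle–Unger arXiv:2211.15742 (extremal horizons form in
positive codimension). [cite: Christodoulou1999, p. A24] -/
def UpgradableCensored (D : InitialDataSet (𝓡 3) X) : Prop :=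
  (∃ 𝒟 : VacuumCauchyDevelopment D, 𝒟.IsMaximal) ∧
    ∀ 𝒟 : VacuumCauchyDevelopment D, 𝒟.IsMaximal →
      Summit.FinalStateConjecture.HasCompleteNullInfinity 𝒟.toCauchyDevelopment ∧
        (WeakHandoff 𝒟 → FullHandoff 𝒟)

/-- **The crux's per-datum property** (`ThriftyHandoff = ∀ X, IsTameChristodoulouGeneric
(admissibleVacuumData X) ThriftyProp 1` by `Iff.rfl`): an MGHD exists and every MGHD has complete
`𝓘⁺`, captures rays for every honest typed decomposition, and admits a (full) thrifty hand-over.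
Dafermos–Luk arXiv:1710.01722, Conjecture 1 and §1.2.1. [cite: DafermosLuk2017, Conjecture 1] -/
def ThriftyProp (D : InitialDataSet (𝓡 3) X) : Prop :=
  (∃ 𝒟 : VacuumCauchyDevelopment D, 𝒟.IsMaximal) ∧
    ∀ 𝒟 : VacuumCauchyDevelopment D, 𝒟.IsMaximal →
      Summit.FinalStateConjecture.HasCompleteNullInfinity 𝒟.toCauchyDevelopment ∧
        RaysCaptured 𝒟 ∧ FullHandoff 𝒟

/-- An upgradably censored datum is censored (drop the upgrade conjunct). [folklore] -/
theorem UpgradableCensored.censored {D : InitialDataSet (𝓡 3) X} (h : UpgradableCensored D) :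
    Censored D :=
  ⟨h.1, fun 𝒟 h𝒟 ↦ (h.2 𝒟 h𝒟).1⟩

/-- **The pointwise upgrade used by the line's glue**: an upgradably censored datum all of whose
censored MGHDs admit a weak hand-over and capture rays has the crux's property. [folklore] -/
theorem thriftyProp_of_upgradableCensored {D : InitialDataSet (𝓡 3) X} (h : UpgradableCensored D)
    (hW : ∀ 𝒟 : VacuumCauchyDevelopment D, 𝒟.IsMaximal →
      Summit.FinalStateConjecture.HasCompleteNullInfinity 𝒟.toCauchyDevelopment → WeakHandoff 𝒟)
    (hR : ∀ 𝒟 : VacuumCauchyDevelopment D, 𝒟.IsMaximal →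
      Summit.FinalStateConjecture.HasCompleteNullInfinity 𝒟.toCauchyDevelopment → RaysCaptured 𝒟) :
    ThriftyProp D :=
  ⟨h.1, fun 𝒟 h𝒟 ↦
    ⟨(h.2 𝒟 h𝒟).1, hR 𝒟 h𝒟 (h.2 𝒟 h𝒟).1, (h.2 𝒟 h𝒟).2 (hW 𝒟 h𝒟 (h.2 𝒟 h𝒟).1)⟩⟩

end Summit.FinalStateConjecture.FinalStateConjecture.Theorems.DerivativeThriftThriftyHandoff

end
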